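import Summits.CriticalPhenomena.PercolationContinuityZ3.Theorems.PercNearOneGluingAdditiveGluingLincombIntegral
import HarnessLib

/-! # Crux `PercNearOneGluing.AdditiveGluing` (stmt-CriticalPhenomena-4576) — tools for the two-contact finger multi-edge Lemma 3 with
# fingers touching the target, part B: pattern-sum algebra, the coordinate-block swap, the pointwise certificate
# (seat (b) V⁺-form, depth prover `png-dp-vplus`)

Support file (`--supports stmt-CriticalPhenomena-4576`); no definitions, no named facts.  Bookkeeping for
`…AdditiveGluingFingerTwoContactsB.lean` (the last `|A| = 4` case of the registered open stub `stub_fingerML3_vp`: two base-weak contact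
relays `w₁, w₂`, fingers may also touch `b`).

* `tcb_reach_union_tri_iff`: reachability of `b` after adding a sub-triangle of virtual pairs on `{w₁, w₂, b}` (the bridge graph of an
  un-glued pattern, or the clique of a glued one), in terms of base reachability; `tcb_bridgeSet_eq_tri`, `tcb_cliqueSet_eq_tri` identify the
  bridge / clique sets of a contact pattern with such a sub-triangle; `tcb_tri_formula_*` collapse the formula into the five connectivity events.
* `tcb_nest5_sum`, `tcb_triple_sum`, `tcb_glued_shape`, `tcb_cross_*`, `tcb_noBridge_shape`: nested-`if` pattern-sum algebra (aggregated masses).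
* `tcb_swap_sum_le`: the COORDINATE-BLOCK SWAP inequality `(Σ_A w)(Σ_B w) ≤ (Σ_C w)(Σ_D w)` for product weights, via the weight-preserving
  injection `(J, J') ↦ (J' ∩ F₁₂, J ∪ (J' ∩ F_b))` — the finger-side inequality `p₁·B₁b' ≤ (1 − B₁)·Q₁b` of the certificate.
* `tcb_twoContactsB_pointwise`: the pointwise bookkeeping of the certificate on the 15 connectivity classes of `{b, d, w₁, w₂}` (generated
  decision tree, one leaf inequality `hR*` per class), to be integrated with `stub_lincombIntegral_c7`.
[cite: KozmaNitzan2024, Lemma 3 (pp. 6–7), §3.1, §3.2 pp. 12–14, §4 p. 20; Grimmett1999, §1.3, §2.2]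
-/

namespace Summit.CriticalPhenomena.PercolationContinuityZ3.Theorems

open MeasureTheory Set
open Literature.Probability.LatticeModels (prodBernoulli)
open Literature.Probability.Percolation

noncomputable section
open Classical

section TwoContactsBToolsB

variable {n : ℕ}
/-- Sum of a five-branch nested `if` against weights = the five class masses times the branch values. [folklore] -/
theorem tcb_nest5_sum {α : Type*} (S : Finset α) (w : α → ℝ) (c p q r : α → Prop) [DecidablePred c] [DecidablePred p]
    [DecidablePred q] [DecidablePred r] (A B C D E : ℝ) :
    ∑ T ∈ S, w T * (if c T then A else if p T then B else if q T then C else if r T then D else E) =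
      A * (∑ T ∈ S, w T * (if c T then 1 else 0)) +
      B * (∑ T ∈ S, w T * (if c T then 0 else if p T then 1 else 0)) +
      C * (∑ T ∈ S, w T * (if c T then 0 else if p T then 0 else if q T then 1 else 0)) +
      D * (∑ T ∈ S, w T * (if c T then 0 else if p T then 0 else if q T then 0 else if r T then 1 else 0)) +
      E * (∑ T ∈ S, w T * (if c T then 0 else if p T then 0 else if q T then 0 else if r T then 0 else 1)) := by
  rw [Finset.mul_sum, Finset.mul_sum, Finset.mul_sum, Finset.mul_sum, Finset.mul_sum, ← Finset.sum_add_distrib,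
    ← Finset.sum_add_distrib, ← Finset.sum_add_distrib, ← Finset.sum_add_distrib]
  refine Finset.sum_congr rfl fun T _ => ?_
  split_ifs <;> ring

/-- Sum of the seven-branch `(tb, t1, t2)` nested `if` against weights. [folklore] -/
theorem tcb_triple_sum {α : Type*} (S : Finset α) (w : α → ℝ) (tb t1 t2 : α → Prop) [DecidablePred tb] [DecidablePred t1]
    [DecidablePred t2] (a b c d e f g : ℝ) :
    ∑ T ∈ S, w T * (if tb T then (if t1 T then (if t2 T then a else b) else (if t2 T then c else d))
      else (if t1 T then (if t2 T then e else f) else g)) =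
      a * (∑ T ∈ S, w T * (if tb T then (if t1 T then (if t2 T then 1 else 0) else 0) else 0)) +
      b * (∑ T ∈ S, w T * (if tb T then (if t1 T then (if t2 T then 0 else 1) else 0) else 0)) +
      c * (∑ T ∈ S, w T * (if tb T then (if t1 T then 0 else (if t2 T then 1 else 0)) else 0)) +
      d * (∑ T ∈ S, w T * (if tb T then (if t1 T then 0 else (if t2 T then 0 else 1)) else 0)) +
      e * (∑ T ∈ S, w T * (if tb T then 0 else (if t1 T then (if t2 T then 1 else 0) else 0))) +
      f * (∑ T ∈ S, w T * (if tb T then 0 else (if t1 T then (if t2 T then 0 else 1) else 0))) +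
      g * (∑ T ∈ S, w T * (if tb T then 0 else (if t1 T then 0 else 1))) := by
  rw [Finset.mul_sum, Finset.mul_sum, Finset.mul_sum, Finset.mul_sum, Finset.mul_sum, Finset.mul_sum, Finset.mul_sum,
    ← Finset.sum_add_distrib, ← Finset.sum_add_distrib, ← Finset.sum_add_distrib, ← Finset.sum_add_distrib,
    ← Finset.sum_add_distrib, ← Finset.sum_add_distrib]
  refine Finset.sum_congr rfl fun T _ => ?_
  split_ifs <;> ring

/-- The "at least two pairs" shape of the glued values equals the `(tb, t1, t2)` triple shape. [folklore] -/
theorem tcb_glued_shape (tb t1 t2 : Prop) [Decidable tb] [Decidable t1] [Decidable t2] (A12bd A12d A1bd A2bd A0d : ℝ) :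
    (if (((t1 ∧ t2) ∧ (t1 ∧ tb)) ∨ ((t1 ∧ t2) ∧ (t2 ∧ tb)) ∨ ((t1 ∧ tb) ∧ (t2 ∧ tb))) then A12bd
      else if (t1 ∧ t2) then A12d else if (t1 ∧ tb) then A1bd else if (t2 ∧ tb) then A2bd else A0d) =
      (if tb then (if t1 then (if t2 then A12bd else A1bd) else (if t2 then A2bd else A0d))
        else (if t1 then (if t2 then A12d else A0d) else A0d)) := by
  by_cases hb : tb <;> by_cases h1 : t1 <;> by_cases h2 : t2 <;> simp [hb, h1, h2]

/-- Cross bound: the classes "only `w₁b`", "only `w₂b`", "at least two bridges" all have `b` touched. [folklore] -/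
theorem tcb_cross_touched_b {α : Type*} (S : Finset α) (w : α → ℝ) (hw : ∀ T, 0 ≤ w T) (tb t1 t2 b12 b1 b2 : α → Prop)
    [DecidablePred tb] [DecidablePred t1] [DecidablePred t2] [DecidablePred b12] [DecidablePred b1] [DecidablePred b2]
    (i1 : ∀ T, b1 T → tb T) (i2 : ∀ T, b2 T → tb T) :
    (∑ T ∈ S, w T * (if ((b12 T ∧ b1 T) ∨ (b12 T ∧ b2 T) ∨ (b1 T ∧ b2 T)) then 0 else if b12 T then 0 else if b1 T then 1 else 0)) +
    (∑ T ∈ S, w T * (if ((b12 T ∧ b1 T) ∨ (b12 T ∧ b2 T) ∨ (b1 T ∧ b2 T)) then 0 else if b12 T then 0 else if b1 T then 0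
      else if b2 T then 1 else 0)) +
    (∑ T ∈ S, w T * (if ((b12 T ∧ b1 T) ∨ (b12 T ∧ b2 T) ∨ (b1 T ∧ b2 T)) then 1 else 0)) ≤
    (∑ T ∈ S, w T * (if tb T then (if t1 T then (if t2 T then 1 else 0) else 0) else 0)) +
    (∑ T ∈ S, w T * (if tb T then (if t1 T then (if t2 T then 0 else 1) else 0) else 0)) +
    (∑ T ∈ S, w T * (if tb T then (if t1 T then 0 else (if t2 T then 1 else 0)) else 0)) +
    (∑ T ∈ S, w T * (if tb T then (if t1 T then 0 else (if t2 T then 0 else 1)) else 0)) := by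
  rw [← Finset.sum_add_distrib, ← Finset.sum_add_distrib, ← Finset.sum_add_distrib, ← Finset.sum_add_distrib,
    ← Finset.sum_add_distrib]
  refine Finset.sum_le_sum fun T _ => ?_
  have h1 := i1 T
  have h2 := i2 T
  have hwT := hw T
  split_ifs <;> first | linarith | (exfalso; tauto)

/-- Cross bound: patterns touching only `w₁` or only `w₂` (not `b`, not both) have no bridge. [folklore] -/
theorem tcb_cross_single_noBridge {α : Type*} (S : Finset α) (w : α → ℝ) (hw : ∀ T, 0 ≤ w T) (tb t1 t2 b12 b1 b2 : α → Prop)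
    [DecidablePred tb] [DecidablePred t1] [DecidablePred t2] [DecidablePred b12] [DecidablePred b1] [DecidablePred b2]
    (i1 : ∀ T, b1 T → tb T) (i2 : ∀ T, b2 T → tb T) (i12 : ∀ T, b12 T → t1 T ∧ t2 T) :
    (∑ T ∈ S, w T * (if tb T then 0 else (if t1 T then (if t2 T then 0 else 1) else 0))) +
    (∑ T ∈ S, w T * (if tb T then 0 else (if t1 T then 0 else 1))) ≤
    (∑ T ∈ S, w T * (if ((b12 T ∧ b1 T) ∨ (b12 T ∧ b2 T) ∨ (b1 T ∧ b2 T)) then 0 else if b12 T then 0 else if b1 T then 0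
      else if b2 T then 0 else 1)) := by
  rw [← Finset.sum_add_distrib]
  refine Finset.sum_le_sum fun T _ => ?_
  have h1 := i1 T
  have h2 := i2 T
  have h12 := i12 T
  have hwT := hw T
  split_ifs <;> first | linarith | (exfalso; tauto)



/-- The "no bridge" indicator in the two shapes used by the bookkeeping. [folklore] -/
theorem tcb_noBridge_shape (b12 b1 b2 : Prop) [Decidable b12] [Decidable b1] [Decidable b2] :
    (if (¬ b12 ∧ ¬ b1 ∧ ¬ b2) then (1 : ℝ) else 0) =
      (if ((b12 ∧ b1) ∨ (b12 ∧ b2) ∨ (b1 ∧ b2)) then 0 else if b12 then 0 else if b1 then 0 else if b2 then 0 else 1) := by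
  by_cases h12 : b12 <;> by_cases h1 : b1 <;> by_cases h2 : b2 <;> simp [h12, h1, h2]


/-- Weight preservation of the coordinate-block swap `(J, J') ↦ (J' ∩ F₁₂, J ∪ (J' ∩ F_b))` for product weights. [folklore] -/
theorem tcb_swap_weight_eq {ι : Type*} [DecidableEq ι] (F12 Fb : Finset ι) (hdisj : Disjoint F12 Fb) (a : ι → ℝ) (J J' : Finset ι) (hJ : J ⊆ F12) :
    (∏ e ∈ F12 ∪ Fb, (if e ∈ J then a e else 1 - a e)) * (∏ e ∈ F12 ∪ Fb, (if e ∈ J' then a e else 1 - a e)) =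
      (∏ e ∈ F12 ∪ Fb, (if e ∈ J' ∩ F12 then a e else 1 - a e)) *
        (∏ e ∈ F12 ∪ Fb, (if e ∈ J ∪ (J' ∩ Fb) then a e else 1 - a e)) := by
  rw [← Finset.prod_mul_distrib, ← Finset.prod_mul_distrib]
  refine Finset.prod_congr rfl fun e he => ?_
  rcases Finset.mem_union.1 he with h12 | hb
  · have hnb : e ∉ Fb := fun h => Finset.disjoint_left.1 hdisj h12 h
    have e1 : (e ∈ J' ∩ F12) ↔ e ∈ J' := by simp [h12]
    have e2 : (e ∈ J ∪ (J' ∩ Fb)) ↔ e ∈ J := by simp [hnb]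
    simp only [e1, e2]
    split_ifs <;> ring
  · have hn12 : e ∉ F12 := fun h => Finset.disjoint_left.1 hdisj h hb
    have hnJ : e ∉ J := fun h => hn12 (hJ h)
    have e1 : ¬ (e ∈ J' ∩ F12) := by simp [hn12]
    have e2 : (e ∈ J ∪ (J' ∩ Fb)) ↔ e ∈ J' := by simp [hnJ, hb]
    simp only [e1, e2, hnJ, if_false]

/-- Injectivity of the swap on `{J ⊆ F₁₂} × {J' ⊆ F₁₂ ∪ F_b}`. [folklore] -/
theorem tcb_swap_injective {ι : Type*} [DecidableEq ι] (F12 Fb : Finset ι) (hdisj : Disjoint F12 Fb) (J₁ J₁' J₂ J₂' : Finset ι)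
    (hJ₁ : J₁ ⊆ F12) (hJ₂ : J₂ ⊆ F12) (hJ₁' : J₁' ⊆ F12 ∪ Fb) (hJ₂' : J₂' ⊆ F12 ∪ Fb)
    (h1 : J₁' ∩ F12 = J₂' ∩ F12) (h2 : J₁ ∪ (J₁' ∩ Fb) = J₂ ∪ (J₂' ∩ Fb)) : J₁ = J₂ ∧ J₁' = J₂' := by
  have hrecJ : ∀ J J' : Finset ι, J ⊆ F12 → (J ∪ (J' ∩ Fb)) ∩ F12 = J := by
    intro J J' hJF
    ext e
    simp only [Finset.mem_inter, Finset.mem_union]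
    constructor
    · rintro ⟨h | ⟨-, heb⟩, he12⟩
      · exact h
      · exact (Finset.disjoint_left.1 hdisj he12 heb).elim
    · exact fun h => ⟨Or.inl h, hJF h⟩
  have hrecJ' : ∀ J J' : Finset ι, J ⊆ F12 → J' ⊆ F12 ∪ Fb → (J' ∩ F12) ∪ ((J ∪ (J' ∩ Fb)) ∩ Fb) = J' := by
    intro J J' hJF hJ'F
    ext e
    simp only [Finset.mem_inter, Finset.mem_union]
    constructor
    · rintro (⟨h, -⟩ | ⟨h | ⟨h, -⟩, heb⟩)
      · exact h
      · exact (Finset.disjoint_left.1 hdisj (hJF h) heb).elim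
      · exact h
    · intro h
      rcases Finset.mem_union.1 (hJ'F h) with h12 | hb
      · exact Or.inl ⟨h, h12⟩
      · exact Or.inr ⟨Or.inr ⟨h, hb⟩, hb⟩
  constructor
  · rw [← hrecJ J₁ J₁' hJ₁, ← hrecJ J₂ J₂' hJ₂, h2]
  · rw [← hrecJ' J₁ J₁' hJ₁ hJ₁', ← hrecJ' J₂ J₂' hJ₂ hJ₂', h1, h2]

/-- **Coordinate-block swap inequality.**  With product weights `w T = ∏_{e ∈ F₁₂ ∪ F_b} (e ∈ T ? a e : 1 − a e)`: if every `J ∈ A` lies in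
`F₁₂`, every `J' ∈ B` in `F₁₂ ∪ F_b`, and the swap maps `A × B` into `C × D`, then `(Σ_A w)(Σ_B w) ≤ (Σ_C w)(Σ_D w)`. [folklore] -/
theorem tcb_swap_sum_le {ι : Type*} [DecidableEq ι] (F12 Fb : Finset ι) (hdisj : Disjoint F12 Fb) (a : ι → ℝ) (ha0 : ∀ e, 0 ≤ a e) (ha1 : ∀ e, a e ≤ 1)
    (A B C D : Finset (Finset ι))
    (hA : ∀ J ∈ A, J ⊆ F12) (hB : ∀ J' ∈ B, J' ⊆ F12 ∪ Fb)
    (hC : ∀ J ∈ A, ∀ J' ∈ B, J' ∩ F12 ∈ C) (hD : ∀ J ∈ A, ∀ J' ∈ B, J ∪ (J' ∩ Fb) ∈ D) :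
    (∑ J ∈ A, ∏ e ∈ F12 ∪ Fb, (if e ∈ J then a e else 1 - a e)) *
        (∑ J' ∈ B, ∏ e ∈ F12 ∪ Fb, (if e ∈ J' then a e else 1 - a e)) ≤
      (∑ J ∈ C, ∏ e ∈ F12 ∪ Fb, (if e ∈ J then a e else 1 - a e)) *
        (∑ J' ∈ D, ∏ e ∈ F12 ∪ Fb, (if e ∈ J' then a e else 1 - a e)) := by
  have hw0 : ∀ T : Finset ι, 0 ≤ ∏ e ∈ F12 ∪ Fb, (if e ∈ T then a e else 1 - a e) := fun T =>
    Finset.prod_nonneg fun e _ => by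
      split_ifs
      · exact ha0 e
      · linarith [ha1 e]
  have hinj : Set.InjOn (fun p : Finset ι × Finset ι => (p.2 ∩ F12, p.1 ∪ (p.2 ∩ Fb))) ↑(A ×ˢ B) := by
    rintro ⟨J₁, J₁'⟩ h₁ ⟨J₂, J₂'⟩ h₂ heq
    obtain ⟨hJ₁, hJ₁'⟩ := Finset.mem_product.1 (Finset.mem_coe.1 h₁)
    obtain ⟨hJ₂, hJ₂'⟩ := Finset.mem_product.1 (Finset.mem_coe.1 h₂)
    simp only [Prod.mk.injEq] at heq
    obtain ⟨e1, e2⟩ := tcb_swap_injective F12 Fb hdisj J₁ J₁' J₂ J₂' (hA _ hJ₁) (hA _ hJ₂) (hB _ hJ₁') (hB _ hJ₂') heq.1 heq.2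
    rw [e1, e2]
  have himg : (A ×ˢ B).image (fun p : Finset ι × Finset ι => (p.2 ∩ F12, p.1 ∪ (p.2 ∩ Fb))) ⊆ C ×ˢ D := by
    intro p hp
    obtain ⟨⟨J, J'⟩, hq, rfl⟩ := Finset.mem_image.1 hp
    obtain ⟨hJ, hJ'⟩ := Finset.mem_product.1 hq
    exact Finset.mem_product.2 ⟨hC J hJ J' hJ', hD J hJ J' hJ'⟩
  rw [Finset.sum_mul_sum, Finset.sum_mul_sum, ← Finset.sum_product', ← Finset.sum_product']
  calc ∑ p ∈ A ×ˢ B, (∏ e ∈ F12 ∪ Fb, (if e ∈ p.1 then a e else 1 - a e)) * (∏ e ∈ F12 ∪ Fb, (if e ∈ p.2 then a e else 1 - a e))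
        = ∑ p ∈ A ×ˢ B, ((∏ e ∈ F12 ∪ Fb, (if e ∈ (p.2 ∩ F12, p.1 ∪ (p.2 ∩ Fb)).1 then a e else 1 - a e)) *
            (∏ e ∈ F12 ∪ Fb, (if e ∈ (p.2 ∩ F12, p.1 ∪ (p.2 ∩ Fb)).2 then a e else 1 - a e))) := by
          refine Finset.sum_congr rfl fun p hp => ?_
          obtain ⟨hJ, -⟩ := Finset.mem_product.1 hp
          exact tcb_swap_weight_eq F12 Fb hdisj a p.1 p.2 (hA _ hJ)
      _ = ∑ p ∈ (A ×ˢ B).image (fun p : Finset ι × Finset ι => (p.2 ∩ F12, p.1 ∪ (p.2 ∩ Fb))),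
            (∏ e ∈ F12 ∪ Fb, (if e ∈ p.1 then a e else 1 - a e)) * (∏ e ∈ F12 ∪ Fb, (if e ∈ p.2 then a e else 1 - a e)) :=
          (Finset.sum_image (f := fun p : Finset ι × Finset ι =>
            (∏ e ∈ F12 ∪ Fb, (if e ∈ p.1 then a e else 1 - a e)) * (∏ e ∈ F12 ∪ Fb, (if e ∈ p.2 then a e else 1 - a e))) hinj).symm
      _ ≤ ∑ p ∈ C ×ˢ D, (∏ e ∈ F12 ∪ Fb, (if e ∈ p.1 then a e else 1 - a e)) * (∏ e ∈ F12 ∪ Fb, (if e ∈ p.2 then a e else 1 - a e)) :=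
          Finset.sum_le_sum_of_subset_of_nonneg himg fun p _ _ => mul_nonneg (hw0 _) (hw0 _)


set_option linter.unusedSimpArgs false in
/-- **Pointwise bookkeeping of the two-contact certificate (fingers may touch `b`).**  For every base configuration `ω`, the
integrand of `target − l1·H₁ − l2·H₂ − y2·(row)` — a combination of indicators of connectivity events among `b, d, w₁, w₂` in the
graph of the pairs of `ω` avoiding the block `N`, with the aggregated pattern masses as coefficients — is non-negative, provided the
fourteen leaf inequalities `hR*` (one per connectivity class) hold. [cite: KozmaNitzan2024, Lemma 3 (pp. 6–7), §4 p. 20] -/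
theorem tcb_twoContactsB_pointwise (N : Finset (Fin n)) (w₁ w₂ d b : Fin n)
    (g1 g2 gb g12 g1b g2b g12b c0 u0 u12 u1 u2 uc l1 l2 y2 : ℝ)
    (hR1 : 0 ≤ c0 * l2 - g2 + l2 * u0 + l2 * u1 - y2) (hR2 : 0 ≤ c0 * l1 - g1 + l1 * u0 + l1 * u2) (hR3 : 0 ≤ c0 * l1 + c0 * l2 - g1 - g12 - g2 + l1 * u0 + l1 * u12 + l2 * u0 + l2 * u12) (hR4 : 0 ≤ c0 * l1 + c0 * l2 - g1 - g12 - g2 + l1 * u0 + l1 * u12 + l1 * u2 + l2 * u0 + l2 * u1 + l2 * u12) (hR5 : 0 ≤ -c0 * l1 - c0 * l2 + g1 + g12 + g12b + g1b + g2 + g2b + gb - l1 * u0 - l1 * u1 - l1 * u12 - l1 * u2 - l1 * uc - l2 * u0 - l2 * u1 - l2 * u12 - l2 * u2 - l2 * uc) (hR6 : 0 ≤ -c0 * l1 + g1 + g1b + gb - l1 * u0 - l1 * u1) (hR7 : 0 ≤ -c0 * l1 + g1 + g12 + g12b + g1b + g2b + gb - l1 * u0 - l1 * u1 - l1 * u12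 - l1 * u2 - l1 * uc - l2 * u12 - l2 * u2 - l2 * uc) (hR8 : 0 ≤ -c0 * l2 + g2 + g2b + gb - l2 * u0 - l2 * u2 + y2) (hR9 : 0 ≤ gb) (hR10 : 0 ≤ g2b + gb + l2 * u1 - l2 * u2) (hR11 : 0 ≤ -c0 * l2 + g12 + g12b + g1b + g2 + g2b + gb - l1 * u1 - l1 * u12 - l1 * uc - l2 * u0 - l2 * u1 - l2 * u12 - l2 * u2 - l2 * uc) (hR12 : 0 ≤ g1b + gb - l1 * u1 + l1 * u2) (hR13 : 0 ≤ g12b + g1b + g2b + gb - l1 * u1 - l1 * u2 - l1 * uc - l2 * u1 - l2 * u2 - l2 * uc) (hR14 : 0 ≤ g12b + g1b + g2b + gb - l1 * u1 - l1 * uc - l2 * u2 - l2 * uc) :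
    ∀ ω : BondConfig (Fin n), 0 ≤ (([((g1), {ω : BondConfig (Fin n) | (openGraph ({e | e ∈ ω ∧ ∀ z ∈ e, z ∉ N} : Set (Sym2 (Fin n)))).Reachable w₁ b}),
      ((g2), {ω : BondConfig (Fin n) | (openGraph ({e | e ∈ ω ∧ ∀ z ∈ e, z ∉ N} : Set (Sym2 (Fin n)))).Reachable w₂ b}),
      ((g12), {ω : BondConfig (Fin n) | (openGraph ({e | e ∈ ω ∧ ∀ z ∈ e, z ∉ N} : Set (Sym2 (Fin n)))).Reachable w₁ b ∨ (openGraph ({e | e ∈ ω ∧ ∀ z ∈ e, z ∉ N} : Set (Sym2 (Fin n)))).Reachable w₂ b}),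
      ((g12b + g1b + g2b + gb), (Set.univ : Set (BondConfig (Fin n)))),
      ((-g1 - g2 - gb), {ω : BondConfig (Fin n) | (openGraph ({e | e ∈ ω ∧ ∀ z ∈ e, z ∉ N} : Set (Sym2 (Fin n)))).Reachable d b}),
      ((-g12), {ω : BondConfig (Fin n) | (openGraph ({e | e ∈ ω ∧ ∀ z ∈ e, z ∉ N} : Set (Sym2 (Fin n)))).Reachable d b ∨ ((openGraph ({e | e ∈ ω ∧ ∀ z ∈ e, z ∉ N} : Set (Sym2 (Fin n)))).Reachable w₂ b ∧ (openGraph ({e | e ∈ ω ∧ ∀ z ∈ e, z ∉ N} : Set (Sym2 (Fin n)))).Reachable d w₁) ∨ ((openGraph ({e | e ∈ ω ∧ ∀ z ∈ e, z ∉ N} : Set (Sym2 (Fin n)))).Reachable w₁ b ∧ (openGraph ({e | e ∈ ω ∧ ∀ z ∈ e, z ∉ N} : Set (Sym2 (Fin n)))).Reachable d w₂)}),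
      ((-g1b), {ω : BondConfig (Fin n) | (openGraph ({e | e ∈ ω ∧ ∀ z ∈ e, z ∉ N} : Set (Sym2 (Fin n)))).Reachable d b ∨ (openGraph ({e | e ∈ ω ∧ ∀ z ∈ e, z ∉ N} : Set (Sym2 (Fin n)))).Reachable d w₁}),
      ((-g2b), {ω : BondConfig (Fin n) | (openGraph ({e | e ∈ ω ∧ ∀ z ∈ e, z ∉ N} : Set (Sym2 (Fin n)))).Reachable d b ∨ (openGraph ({e | e ∈ ω ∧ ∀ z ∈ e, z ∉ N} : Set (Sym2 (Fin n)))).Reachable d w₂}),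
      ((-g12b), {ω : BondConfig (Fin n) | (openGraph ({e | e ∈ ω ∧ ∀ z ∈ e, z ∉ N} : Set (Sym2 (Fin n)))).Reachable d b ∨ (openGraph ({e | e ∈ ω ∧ ∀ z ∈ e, z ∉ N} : Set (Sym2 (Fin n)))).Reachable d w₁ ∨ (openGraph ({e | e ∈ ω ∧ ∀ z ∈ e, z ∉ N} : Set (Sym2 (Fin n)))).Reachable d w₂}),
      ((-(c0 * l1) - (l1 * u0)), {ω : BondConfig (Fin n) | (openGraph ({e | e ∈ ω ∧ ∀ z ∈ e, z ∉ N} : Set (Sym2 (Fin n)))).Reachable w₁ b}),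
      ((-(l1 * u12)), {ω : BondConfig (Fin n) | (openGraph ({e | e ∈ ω ∧ ∀ z ∈ e, z ∉ N} : Set (Sym2 (Fin n)))).Reachable w₁ b ∨ (openGraph ({e | e ∈ ω ∧ ∀ z ∈ e, z ∉ N} : Set (Sym2 (Fin n)))).Reachable w₂ b}),
      ((-(l1 * u1) - (l1 * uc)), (Set.univ : Set (BondConfig (Fin n)))),
      ((-(l1 * u2)), {ω : BondConfig (Fin n) | (openGraph ({e | e ∈ ω ∧ ∀ z ∈ e, z ∉ N} : Set (Sym2 (Fin n)))).Reachable w₁ b ∨ (openGraph ({e | e ∈ ω ∧ ∀ z ∈ e, z ∉ N} : Set (Sym2 (Fin n)))).Reachable w₁ w₂}),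
      ((c0 * l1 + l1 * u0), {ω : BondConfig (Fin n) | (openGraph ({e | e ∈ ω ∧ ∀ z ∈ e, z ∉ N} : Set (Sym2 (Fin n)))).Reachable d b}),
      ((l1 * u12), {ω : BondConfig (Fin n) | (openGraph ({e | e ∈ ω ∧ ∀ z ∈ e, z ∉ N} : Set (Sym2 (Fin n)))).Reachable d b ∨ ((openGraph ({e | e ∈ ω ∧ ∀ z ∈ e, z ∉ N} : Set (Sym2 (Fin n)))).Reachable w₂ b ∧ (openGraph ({e | e ∈ ω ∧ ∀ z ∈ e, z ∉ N} : Set (Sym2 (Fin n)))).Reachable d w₁) ∨ ((openGraph ({e | e ∈ ω ∧ ∀ z ∈ e, z ∉ N} : Set (Sym2 (Fin n)))).Reachable w₁ b ∧ (openGraph ({e | e ∈ ω ∧ ∀ z ∈ e, z ∉ N} : Set (Sym2 (Fin n)))).Reachable d w₂)}),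
      ((l1 * u1), {ω : BondConfig (Fin n) | (openGraph ({e | e ∈ ω ∧ ∀ z ∈ e, z ∉ N} : Set (Sym2 (Fin n)))).Reachable d b ∨ (openGraph ({e | e ∈ ω ∧ ∀ z ∈ e, z ∉ N} : Set (Sym2 (Fin n)))).Reachable d w₁}),
      ((l1 * u2), {ω : BondConfig (Fin n) | (openGraph ({e | e ∈ ω ∧ ∀ z ∈ e, z ∉ N} : Set (Sym2 (Fin n)))).Reachable d b ∨ (openGraph ({e | e ∈ ω ∧ ∀ z ∈ e, z ∉ N} : Set (Sym2 (Fin n)))).Reachable d w₂}),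
      ((l1 * uc), {ω : BondConfig (Fin n) | (openGraph ({e | e ∈ ω ∧ ∀ z ∈ e, z ∉ N} : Set (Sym2 (Fin n)))).Reachable d b ∨ (openGraph ({e | e ∈ ω ∧ ∀ z ∈ e, z ∉ N} : Set (Sym2 (Fin n)))).Reachable d w₁ ∨ (openGraph ({e | e ∈ ω ∧ ∀ z ∈ e, z ∉ N} : Set (Sym2 (Fin n)))).Reachable d w₂}),
      ((-(c0 * l2) - (l2 * u0)), {ω : BondConfig (Fin n) | (openGraph ({e | e ∈ ω ∧ ∀ z ∈ e, z ∉ N} : Set (Sym2 (Fin n)))).Reachable w₂ b}),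
      ((-(l2 * u12)), {ω : BondConfig (Fin n) | (openGraph ({e | e ∈ ω ∧ ∀ z ∈ e, z ∉ N} : Set (Sym2 (Fin n)))).Reachable w₁ b ∨ (openGraph ({e | e ∈ ω ∧ ∀ z ∈ e, z ∉ N} : Set (Sym2 (Fin n)))).Reachable w₂ b}),
      ((-(l2 * u1)), {ω : BondConfig (Fin n) | (openGraph ({e | e ∈ ω ∧ ∀ z ∈ e, z ∉ N} : Set (Sym2 (Fin n)))).Reachable w₂ b ∨ (openGraph ({e | e ∈ ω ∧ ∀ z ∈ e, z ∉ N} : Set (Sym2 (Fin n)))).Reachable w₂ w₁}),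
      ((-(l2 * u2) - (l2 * uc)), (Set.univ : Set (BondConfig (Fin n)))),
      ((c0 * l2 + l2 * u0), {ω : BondConfig (Fin n) | (openGraph ({e | e ∈ ω ∧ ∀ z ∈ e, z ∉ N} : Set (Sym2 (Fin n)))).Reachable d b}),
      ((l2 * u12), {ω : BondConfig (Fin n) | (openGraph ({e | e ∈ ω ∧ ∀ z ∈ e, z ∉ N} : Set (Sym2 (Fin n)))).Reachable d b ∨ ((openGraph ({e | e ∈ ω ∧ ∀ z ∈ e, z ∉ N} : Set (Sym2 (Fin n)))).Reachable w₂ b ∧ (openGraph ({e | e ∈ ω ∧ ∀ z ∈ e, z ∉ N} : Set (Sym2 (Fin n)))).Reachable d w₁) ∨ ((openGraph ({e | e ∈ ω ∧ ∀ z ∈ e, z ∉ N} : Set (Sym2 (Fin n)))).Reachable w₁ b ∧ (openGraph ({e | e ∈ ω ∧ ∀ z ∈ e, z ∉ N} : Set (Sym2 (Fin n)))).Reachable d w₂)}),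
      ((l2 * u1), {ω : BondConfig (Fin n) | (openGraph ({e | e ∈ ω ∧ ∀ z ∈ e, z ∉ N} : Set (Sym2 (Fin n)))).Reachable d b ∨ (openGraph ({e | e ∈ ω ∧ ∀ z ∈ e, z ∉ N} : Set (Sym2 (Fin n)))).Reachable d w₁}),
      ((l2 * u2), {ω : BondConfig (Fin n) | (openGraph ({e | e ∈ ω ∧ ∀ z ∈ e, z ∉ N} : Set (Sym2 (Fin n)))).Reachable d b ∨ (openGraph ({e | e ∈ ω ∧ ∀ z ∈ e, z ∉ N} : Set (Sym2 (Fin n)))).Reachable d w₂}),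
      ((l2 * uc), {ω : BondConfig (Fin n) | (openGraph ({e | e ∈ ω ∧ ∀ z ∈ e, z ∉ N} : Set (Sym2 (Fin n)))).Reachable d b ∨ (openGraph ({e | e ∈ ω ∧ ∀ z ∈ e, z ∉ N} : Set (Sym2 (Fin n)))).Reachable d w₁ ∨ (openGraph ({e | e ∈ ω ∧ ∀ z ∈ e, z ∉ N} : Set (Sym2 (Fin n)))).Reachable d w₂}),
      ((-y2), {ω : BondConfig (Fin n) | (openGraph ({e | e ∈ ω ∧ ∀ z ∈ e, z ∉ N} : Set (Sym2 (Fin n)))).Reachable d b ∧ (openGraph ({e | e ∈ ω ∧ ∀ z ∈ e, z ∉ N} : Set (Sym2 (Fin n)))).Reachable d w₁}),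
      ((y2), {ω : BondConfig (Fin n) | (openGraph ({e | e ∈ ω ∧ ∀ z ∈ e, z ∉ N} : Set (Sym2 (Fin n)))).Reachable w₂ b ∧ (openGraph ({e | e ∈ ω ∧ ∀ z ∈ e, z ∉ N} : Set (Sym2 (Fin n)))).Reachable d w₁})] : List (ℝ × Set (BondConfig (Fin n)))).map
      fun ce => ce.1 * ce.2.indicator (1 : BondConfig (Fin n) → ℝ) ω).sum := by
  intro ω
  by_cases c_db : (openGraph ({e | e ∈ ω ∧ ∀ z ∈ e, z ∉ N} : Set (Sym2 (Fin n)))).Reachable d b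
  · by_cases c_d1 : (openGraph ({e | e ∈ ω ∧ ∀ z ∈ e, z ∉ N} : Set (Sym2 (Fin n)))).Reachable d w₁
    · by_cases c_d2 : (openGraph ({e | e ∈ ω ∧ ∀ z ∈ e, z ∉ N} : Set (Sym2 (Fin n)))).Reachable d w₂
      · have c_1b : (openGraph ({e | e ∈ ω ∧ ∀ z ∈ e, z ∉ N} : Set (Sym2 (Fin n)))).Reachable w₁ b := (c_d1.symm.trans c_db)
        have c_2b : (openGraph ({e | e ∈ ω ∧ ∀ z ∈ e, z ∉ N} : Set (Sym2 (Fin n)))).Reachable w₂ b := (c_d2.symm.trans c_db)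
        have c_12 : (openGraph ({e | e ∈ ω ∧ ∀ z ∈ e, z ∉ N} : Set (Sym2 (Fin n)))).Reachable w₁ w₂ := (c_d1.symm.trans c_d2)
        have c_21 : (openGraph ({e | e ∈ ω ∧ ∀ z ∈ e, z ∉ N} : Set (Sym2 (Fin n)))).Reachable w₂ w₁ := c_12.symm
        simp only [c_db, c_d1, c_d2, c_1b, c_2b, c_12, c_21, List.map_cons, List.map_nil, List.sum_cons, List.sum_nil, Set.indicator_apply, Set.mem_setOf_eq, Set.mem_univ, Pi.one_apply, if_true, if_false, true_and, and_true, false_and, and_false, true_or, or_true, false_or, or_false, mul_one, mul_zero, add_zero, zero_add]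
        linarith
      · have c_1b : (openGraph ({e | e ∈ ω ∧ ∀ z ∈ e, z ∉ N} : Set (Sym2 (Fin n)))).Reachable w₁ b := (c_d1.symm.trans c_db)
        have c_2b : ¬ (openGraph ({e | e ∈ ω ∧ ∀ z ∈ e, z ∉ N} : Set (Sym2 (Fin n)))).Reachable w₂ b := fun e => c_d2 (c_db.trans e.symm)
        have c_12 : ¬ (openGraph ({e | e ∈ ω ∧ ∀ z ∈ e, z ∉ N} : Set (Sym2 (Fin n)))).Reachable w₁ w₂ := fun e => c_2b (e.symm.trans c_1b)
        have c_21 : ¬ (openGraph ({e | e ∈ ω ∧ ∀ z ∈ e, z ∉ N} : Set (Sym2 (Fin n)))).Reachable w₂ w₁ := fun e => c_12 e.symm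
        simp only [c_db, c_d1, c_d2, c_1b, c_2b, c_12, c_21, List.map_cons, List.map_nil, List.sum_cons, List.sum_nil, Set.indicator_apply, Set.mem_setOf_eq, Set.mem_univ, Pi.one_apply, if_true, if_false, true_and, and_true, false_and, and_false, true_or, or_true, false_or, or_false, mul_one, mul_zero, add_zero, zero_add]
        linarith only [hR1]
    · by_cases c_d2 : (openGraph ({e | e ∈ ω ∧ ∀ z ∈ e, z ∉ N} : Set (Sym2 (Fin n)))).Reachable d w₂
      · have c_1b : ¬ (openGraph ({e | e ∈ ω ∧ ∀ z ∈ e, z ∉ N} : Set (Sym2 (Fin n)))).Reachable w₁ b := fun e => c_d1 (c_db.trans e.symm)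
        have c_2b : (openGraph ({e | e ∈ ω ∧ ∀ z ∈ e, z ∉ N} : Set (Sym2 (Fin n)))).Reachable w₂ b := (c_d2.symm.trans c_db)
        have c_12 : ¬ (openGraph ({e | e ∈ ω ∧ ∀ z ∈ e, z ∉ N} : Set (Sym2 (Fin n)))).Reachable w₁ w₂ := fun e => c_1b (e.trans c_2b)
        have c_21 : ¬ (openGraph ({e | e ∈ ω ∧ ∀ z ∈ e, z ∉ N} : Set (Sym2 (Fin n)))).Reachable w₂ w₁ := fun e => c_12 e.symm
        simp only [c_db, c_d1, c_d2, c_1b, c_2b, c_12, c_21, List.map_cons, List.map_nil, List.sum_cons, List.sum_nil, Set.indicator_apply, Set.mem_setOf_eq, Set.mem_univ, Pi.one_apply, if_true, if_false, true_and, and_true, false_and, and_false, true_or, or_true, false_or, or_false, mul_one, mul_zero, add_zero, zero_add]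
        linarith only [hR2]
      · have c_1b : ¬ (openGraph ({e | e ∈ ω ∧ ∀ z ∈ e, z ∉ N} : Set (Sym2 (Fin n)))).Reachable w₁ b := fun e => c_d1 (c_db.trans e.symm)
        have c_2b : ¬ (openGraph ({e | e ∈ ω ∧ ∀ z ∈ e, z ∉ N} : Set (Sym2 (Fin n)))).Reachable w₂ b := fun e => c_d2 (c_db.trans e.symm)
        by_cases c_12 : (openGraph ({e | e ∈ ω ∧ ∀ z ∈ e, z ∉ N} : Set (Sym2 (Fin n)))).Reachable w₁ w₂
        · have c_21 : (openGraph ({e | e ∈ ω ∧ ∀ z ∈ e, z ∉ N} : Set (Sym2 (Fin n)))).Reachable w₂ w₁ := c_12.symm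
          simp only [c_db, c_d1, c_d2, c_1b, c_2b, c_12, c_21, List.map_cons, List.map_nil, List.sum_cons, List.sum_nil, Set.indicator_apply, Set.mem_setOf_eq, Set.mem_univ, Pi.one_apply, if_true, if_false, true_and, and_true, false_and, and_false, true_or, or_true, false_or, or_false, mul_one, mul_zero, add_zero, zero_add]
          linarith only [hR3]
        · have c_21 : ¬ (openGraph ({e | e ∈ ω ∧ ∀ z ∈ e, z ∉ N} : Set (Sym2 (Fin n)))).Reachable w₂ w₁ := fun e => c_12 e.symm
          simp only [c_db, c_d1, c_d2, c_1b, c_2b, c_12, c_21, List.map_cons, List.map_nil, List.sum_cons, List.sum_nil, Set.indicator_apply, Set.mem_setOf_eq, Set.mem_univ, Pi.one_apply, if_true, if_false, true_and, and_true, false_and, and_false, true_or, or_true, false_or, or_false, mul_one, mul_zero, add_zero, zero_add]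
          linarith only [hR4]
  · by_cases c_d1 : (openGraph ({e | e ∈ ω ∧ ∀ z ∈ e, z ∉ N} : Set (Sym2 (Fin n)))).Reachable d w₁
    · by_cases c_d2 : (openGraph ({e | e ∈ ω ∧ ∀ z ∈ e, z ∉ N} : Set (Sym2 (Fin n)))).Reachable d w₂
      · have c_1b : ¬ (openGraph ({e | e ∈ ω ∧ ∀ z ∈ e, z ∉ N} : Set (Sym2 (Fin n)))).Reachable w₁ b := fun e => c_db (c_d1.trans e)
        have c_2b : ¬ (openGraph ({e | e ∈ ω ∧ ∀ z ∈ e, z ∉ N} : Set (Sym2 (Fin n)))).Reachable w₂ b := fun e => c_1b ((c_d1.symm.trans c_d2).trans e)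
        have c_12 : (openGraph ({e | e ∈ ω ∧ ∀ z ∈ e, z ∉ N} : Set (Sym2 (Fin n)))).Reachable w₁ w₂ := (c_d1.symm.trans c_d2)
        have c_21 : (openGraph ({e | e ∈ ω ∧ ∀ z ∈ e, z ∉ N} : Set (Sym2 (Fin n)))).Reachable w₂ w₁ := c_12.symm
        simp only [c_db, c_d1, c_d2, c_1b, c_2b, c_12, c_21, List.map_cons, List.map_nil, List.sum_cons, List.sum_nil, Set.indicator_apply, Set.mem_setOf_eq, Set.mem_univ, Pi.one_apply, if_true, if_false, true_and, and_true, false_and, and_false, true_or, or_true, false_or, or_false, mul_one, mul_zero, add_zero, zero_add]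
        linarith only [hR9]
      · have c_1b : ¬ (openGraph ({e | e ∈ ω ∧ ∀ z ∈ e, z ∉ N} : Set (Sym2 (Fin n)))).Reachable w₁ b := fun e => c_db (c_d1.trans e)
        by_cases c_2b : (openGraph ({e | e ∈ ω ∧ ∀ z ∈ e, z ∉ N} : Set (Sym2 (Fin n)))).Reachable w₂ b
        · have c_12 : ¬ (openGraph ({e | e ∈ ω ∧ ∀ z ∈ e, z ∉ N} : Set (Sym2 (Fin n)))).Reachable w₁ w₂ := fun e => c_1b (e.trans c_2b)
          have c_21 : ¬ (openGraph ({e | e ∈ ω ∧ ∀ z ∈ e, z ∉ N} : Set (Sym2 (Fin n)))).Reachable w₂ w₁ := fun e => c_12 e.symm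
          simp only [c_db, c_d1, c_d2, c_1b, c_2b, c_12, c_21, List.map_cons, List.map_nil, List.sum_cons, List.sum_nil, Set.indicator_apply, Set.mem_setOf_eq, Set.mem_univ, Pi.one_apply, if_true, if_false, true_and, and_true, false_and, and_false, true_or, or_true, false_or, or_false, mul_one, mul_zero, add_zero, zero_add]
          linarith only [hR8]
        · have c_12 : ¬ (openGraph ({e | e ∈ ω ∧ ∀ z ∈ e, z ∉ N} : Set (Sym2 (Fin n)))).Reachable w₁ w₂ := fun e => c_d2 (c_d1.trans e)
          have c_21 : ¬ (openGraph ({e | e ∈ ω ∧ ∀ z ∈ e, z ∉ N} : Set (Sym2 (Fin n)))).Reachable w₂ w₁ := fun e => c_12 e.symm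
          simp only [c_db, c_d1, c_d2, c_1b, c_2b, c_12, c_21, List.map_cons, List.map_nil, List.sum_cons, List.sum_nil, Set.indicator_apply, Set.mem_setOf_eq, Set.mem_univ, Pi.one_apply, if_true, if_false, true_and, and_true, false_and, and_false, true_or, or_true, false_or, or_false, mul_one, mul_zero, add_zero, zero_add]
          linarith only [hR10]
    · by_cases c_d2 : (openGraph ({e | e ∈ ω ∧ ∀ z ∈ e, z ∉ N} : Set (Sym2 (Fin n)))).Reachable d w₂
      · by_cases c_1b : (openGraph ({e | e ∈ ω ∧ ∀ z ∈ e, z ∉ N} : Set (Sym2 (Fin n)))).Reachable w₁ b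
        · have c_2b : ¬ (openGraph ({e | e ∈ ω ∧ ∀ z ∈ e, z ∉ N} : Set (Sym2 (Fin n)))).Reachable w₂ b := fun e => c_d1 ((c_d2.trans e).trans c_1b.symm)
          have c_12 : ¬ (openGraph ({e | e ∈ ω ∧ ∀ z ∈ e, z ∉ N} : Set (Sym2 (Fin n)))).Reachable w₁ w₂ := fun e => c_2b (e.symm.trans c_1b)
          have c_21 : ¬ (openGraph ({e | e ∈ ω ∧ ∀ z ∈ e, z ∉ N} : Set (Sym2 (Fin n)))).Reachable w₂ w₁ := fun e => c_12 e.symm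
          simp only [c_db, c_d1, c_d2, c_1b, c_2b, c_12, c_21, List.map_cons, List.map_nil, List.sum_cons, List.sum_nil, Set.indicator_apply, Set.mem_setOf_eq, Set.mem_univ, Pi.one_apply, if_true, if_false, true_and, and_true, false_and, and_false, true_or, or_true, false_or, or_false, mul_one, mul_zero, add_zero, zero_add]
          linarith only [hR6]
        · have c_2b : ¬ (openGraph ({e | e ∈ ω ∧ ∀ z ∈ e, z ∉ N} : Set (Sym2 (Fin n)))).Reachable w₂ b := fun e => c_db (c_d2.trans e)
          have c_12 : ¬ (openGraph ({e | e ∈ ω ∧ ∀ z ∈ e, z ∉ N} : Set (Sym2 (Fin n)))).Reachable w₁ w₂ := fun e => c_d1 (c_d2.trans e.symm)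
          have c_21 : ¬ (openGraph ({e | e ∈ ω ∧ ∀ z ∈ e, z ∉ N} : Set (Sym2 (Fin n)))).Reachable w₂ w₁ := fun e => c_12 e.symm
          simp only [c_db, c_d1, c_d2, c_1b, c_2b, c_12, c_21, List.map_cons, List.map_nil, List.sum_cons, List.sum_nil, Set.indicator_apply, Set.mem_setOf_eq, Set.mem_univ, Pi.one_apply, if_true, if_false, true_and, and_true, false_and, and_false, true_or, or_true, false_or, or_false, mul_one, mul_zero, add_zero, zero_add]
          linarith only [hR12]
      · by_cases c_1b : (openGraph ({e | e ∈ ω ∧ ∀ z ∈ e, z ∉ N} : Set (Sym2 (Fin n)))).Reachable w₁ b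
        · by_cases c_2b : (openGraph ({e | e ∈ ω ∧ ∀ z ∈ e, z ∉ N} : Set (Sym2 (Fin n)))).Reachable w₂ b
          · have c_12 : (openGraph ({e | e ∈ ω ∧ ∀ z ∈ e, z ∉ N} : Set (Sym2 (Fin n)))).Reachable w₁ w₂ := (c_1b.trans c_2b.symm)
            have c_21 : (openGraph ({e | e ∈ ω ∧ ∀ z ∈ e, z ∉ N} : Set (Sym2 (Fin n)))).Reachable w₂ w₁ := c_12.symm
            simp only [c_db, c_d1, c_d2, c_1b, c_2b, c_12, c_21, List.map_cons, List.map_nil, List.sum_cons, List.sum_nil, Set.indicator_apply, Set.mem_setOf_eq, Set.mem_univ, Pi.one_apply, if_true, if_false, true_and, and_true, false_and, and_false, true_or, or_true, false_or, or_false, mul_one, mul_zero, add_zero, zero_add]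
            linarith only [hR5]
          · have c_12 : ¬ (openGraph ({e | e ∈ ω ∧ ∀ z ∈ e, z ∉ N} : Set (Sym2 (Fin n)))).Reachable w₁ w₂ := fun e => c_2b (e.symm.trans c_1b)
            have c_21 : ¬ (openGraph ({e | e ∈ ω ∧ ∀ z ∈ e, z ∉ N} : Set (Sym2 (Fin n)))).Reachable w₂ w₁ := fun e => c_12 e.symm
            simp only [c_db, c_d1, c_d2, c_1b, c_2b, c_12, c_21, List.map_cons, List.map_nil, List.sum_cons, List.sum_nil, Set.indicator_apply, Set.mem_setOf_eq, Set.mem_univ, Pi.one_apply, if_true, if_false, true_and, and_true, false_and, and_false, true_or, or_true, false_or, or_false, mul_one, mul_zero, add_zero, zero_add]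
            linarith only [hR7]
        · by_cases c_2b : (openGraph ({e | e ∈ ω ∧ ∀ z ∈ e, z ∉ N} : Set (Sym2 (Fin n)))).Reachable w₂ b
          · have c_12 : ¬ (openGraph ({e | e ∈ ω ∧ ∀ z ∈ e, z ∉ N} : Set (Sym2 (Fin n)))).Reachable w₁ w₂ := fun e => c_1b (e.trans c_2b)
            have c_21 : ¬ (openGraph ({e | e ∈ ω ∧ ∀ z ∈ e, z ∉ N} : Set (Sym2 (Fin n)))).Reachable w₂ w₁ := fun e => c_12 e.symm
            simp only [c_db, c_d1, c_d2, c_1b, c_2b, c_12, c_21, List.map_cons, List.map_nil, List.sum_cons, List.sum_nil, Set.indicator_apply, Set.mem_setOf_eq, Set.mem_univ, Pi.one_apply, if_true, if_false, true_and, and_true, false_and, and_false, true_or, or_true, false_or, or_false, mul_one, mul_zero, add_zero, zero_add]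
            linarith only [hR11]
          · by_cases c_12 : (openGraph ({e | e ∈ ω ∧ ∀ z ∈ e, z ∉ N} : Set (Sym2 (Fin n)))).Reachable w₁ w₂
            · have c_21 : (openGraph ({e | e ∈ ω ∧ ∀ z ∈ e, z ∉ N} : Set (Sym2 (Fin n)))).Reachable w₂ w₁ := c_12.symm
              simp only [c_db, c_d1, c_d2, c_1b, c_2b, c_12, c_21, List.map_cons, List.map_nil, List.sum_cons, List.sum_nil, Set.indicator_apply, Set.mem_setOf_eq, Set.mem_univ, Pi.one_apply, if_true, if_false, true_and, and_true, false_and, and_false, true_or, or_true, false_or, or_false, mul_one, mul_zero, add_zero, zero_add]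
              linarith only [hR13]
            · have c_21 : ¬ (openGraph ({e | e ∈ ω ∧ ∀ z ∈ e, z ∉ N} : Set (Sym2 (Fin n)))).Reachable w₂ w₁ := fun e => c_12 e.symm
              simp only [c_db, c_d1, c_d2, c_1b, c_2b, c_12, c_21, List.map_cons, List.map_nil, List.sum_cons, List.sum_nil, Set.indicator_apply, Set.mem_setOf_eq, Set.mem_univ, Pi.one_apply, if_true, if_false, true_and, and_true, false_and, and_false, true_or, or_true, false_or, or_false, mul_one, mul_zero, add_zero, zero_add]
              linarith only [hR14]


end TwoContactsBToolsB

end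

end Summit.CriticalPhenomena.PercolationContinuityZ3.Theorems
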